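import Summits.HodgeConjecture.HodgeConjecture.Theorems.Ring2AbelianAllCMAlgebraicCarriersDefs
import Literature.AlgebraicGeometry.HodgeTheory.WeilClassesLocalTensorAnchor
import HarnessLib

/-!
# Ring 2 / AbelianAll (André column) — the node «CARRIERS FOR WEIL CLASSES AT TENSOR POINTS» of the implication table (definitions only)

research route, not a corollary; conditional on HC_CM plus one named minimal statement.

DEFINITIONS ONLY (nothing asserted, nothing proved; `HC_CM` absent). PART AB (ab-andre-2 gen 59) localised the `HC_CM` step of André's
reduction to ELLIPTIC-POWER anchors and served there ALL algebraic (= Lefschetz) classes (`EllipticPowerAlgebraicCarriers 𝒪`). The fibre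
`X_{s₀}` of André's Lemme 6.3.3 is more special than «isogenous to a power of an elliptic curve»: it is the TENSOR POINT `V₀ ⊗ E`
(«Posons `V := V₀ ⊗ E`», p. 33), i.e. — for `E = K = ℚ(√-p)` imaginary quadratic — an abelian `2k`-fold `K`-isogenous to Deligne's split
square `(A₁ × A₁, Ψ₀)`, `Ψ₀(x, y) = (-p·y, x)` (LNM 900, Thm. 4.8 (b), Remark 4.10: `A₀ ⊗ K`), and the class to be served there is not an
arbitrary algebraic class but a WEIL CLASS of the tensor structure (the global section `ξ̃` lies in the constant local system `⋀^{2k}_K V`;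
at the split square the Weil plane is `ℂ·(R + i√p·S)ᵏ ⊕ ℂ·(R − i√p·S)ᵏ` for two rational divisor classes `R`, `S` — the tree's
`weilClassesOf_splitSquare_eq_span`, fact-free — in particular ALGEBRAIC and NON-EXCEPTIONAL, `weilClassesOf_le_algebraicClasses_of_tensorPoint`).
For imaginary quadratic `K` this is EXACTLY the anchor family of the cell's Weil ladder (`b2b-hweil`): its LOCAL predicate
`HodgeTheory.HasLocallyAlgebraicTensorAnchors k p` («at every tensor point, every rational Weil class is algebraic on a neighbourhood along
every Weil family through it, up to `q·Hᵏ`») is, with Deligne's family through the target (`deligne1982_weilFamily_hodgeWeilSection`), what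
the kernel theorem `WeilTypeLadder.weilClass_algebraic_of_deligne_of_tensorLocalAnchors` turns into the algebraicity of EVERY Weil class of
EVERY `(X, Φ)`, `Φ² = -p` (`p` prime, `p ≡ 3 (4)`, `p ≥ 7`; all discriminants), hence into the cruxes `HeckePrymWeil.WeilSixfoldsSqrtMinus7`
(stmt-HodgeConjecture-1260) and `HeckePrymWeil.WeilTenfoldsSqrtMinus11` (stmt-1262).

This file NAMES, in the road's per-variety carrier vocabulary (PART AA-a `AnchoredCarrierAt`), the statement that FEEDS that predicate
(companion proof file `Ring2AbelianAllTensorWeilCarriers`: door ∧ node ⟹ `HasLocallyAlgebraicTensorAnchors k p`, by the LOCAL served-fibre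
lemma `VHCAbelianSchemesRoadServedFibreLocal`):

* `IsTensorPoint k p Y Ψ` (reducible): `dim Y = 2k`, `Ψ ≫ Ψ = -p`, and `(Y, Ψ)` carries a `K`-equivariant isogeny pair towards Deligne's
  split square `(A₁ × A₁, Ψ₀)`, `dim A₁ = k` — VERBATIM the tensor-point clause of `HasLocallyAlgebraicTensorAnchors`.
* `tensorPolarisedAnchor k p` (anchor predicate): `X ≅ Y.X` for a tensor point `(Y, Ψ)`, and `θ` is a polarisation class of `X`.
* `tensorWeilServedClasses k p` (served-class map): the classes `w` on `X` that are WEIL CLASSES `e^*w ∈ weilClassesOf Y Ψ k p` for some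
  tensor structure `e : Y.X ≅ X` — a `2`-dimensional space per structure (van Geemen Lemma 5.2 (5)), inside the Lefschetz classes.
* `TensorWeilCarriers 𝒪 k p` (`@[conjecture]`, door-generic): `AnchoredCarrierAt 𝒪 (2k) k (tensorPolarisedAnchor k p) (tensorWeilServedClasses k p)`
  — at every polarised tensor point, for every RATIONAL Weil class `w` of a tensor structure on it, an `𝒪`-admissible datum `(I ∋ k, κ)` ON IT
  with `κ_k = a·w + c_k·θᵏ`, `a ≠ 0`, `κ_q = c_q·θ^q` (`q ∈ I`, `q ≠ k`): Bloch's semiregular-representative problem `a·z₀ + b·l₀ᵏ` for the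
  KNOWN cycles `Re/Im (R + i√p·S)ᵏ` (signed sums of classes of abelian subvarieties) on `A₁ × A₁` and its `K`-isogenous copies.
* `TensorWeilTwistedCarriers k p` (`@[conjecture]`): the same for the road's twisted door `twistedReflexiveClass C AdmTw`, every `C`
  (`AdmTw := gluableSigmaAdmissible ∨ bfSingleAdmissible`, as in the crux `SemiregularSheafRepresentativesTwAtDiag`).

Both nodes are OPEN, not in print (the only semiregular carriers of Weil classes in print are Markman's secant sheaves at the SECANT anchors
`Pic²(C) × Pic²(C)^`, arXiv:2502.03415 Thm. 1.4.1, PREPRINT — not at tensor points), NOT implied by the Hodge conjecture (a carrier is more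
than algebraicity; the Weil classes of a tensor point ARE algebraic, unconditionally) — HYPOTHESES wherever used, never cited as facts;
implied by PART AB-b's `AbelianDesigns 𝒪` (companion file). References: [cite: Andre1996Motifs, Lemme 6.3.3 and proof (p. 33: V := V₀ ⊗ E)]
[cite: Deligne1982HodgeCycles, §4 Thm. 4.8 (b), Lemma 4.5 and Remark 4.10] [cite: vanGeemen1994HodgeAV, 4.9, Lemma 5.2 and 5.3–5.7]
[cite: Bloch1972Semiregularity, Remark (7.5)] [cite: BuchweitzFlenner2003, §5 Thm. 5.1] [cite: Markman2025SecantWeil, Thm. 1.4.1 and §7.3].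
-/

noncomputable section

open CategoryTheory CategoryTheory.Limits AlgebraicGeometry Topology

namespace Summit.HodgeConjecture.HodgeConjecture.Ring2.AbelianAll

-- the cell's namespace repeats the summit name (`Summit.HodgeConjecture.HodgeConjecture…`), as in every `Ring2*` file
set_option linter.dupNamespace false

open Literature.AlgebraicGeometry Literature.AlgebraicGeometry.Motives
open Literature.AlgebraicGeometry.HodgeTheory
open Literature.AlgebraicTopology.SingularHomology
open Summit.Ventures.HSemireg (ObjClass)
open Summit.HodgeConjecture.HodgeConjecture.Ring2.SemiregularRepresentatives (AnchoredCarrierAt)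

/-- **Tensor points** (`IsTensorPoint k p Y Ψ`, reducible): the complex abelian variety `Y` has dimension `2k`, `Ψ ≫ Ψ = -p`, and `(Y, Ψ)`
carries an isogeny pair `f₁ : Y ⟶ A₁ × A₁`, `g₁ : A₁ × A₁ ⟶ Y` (`f₁ ≫ g₁ = m`, `m ≥ 1`, `f₁` flat) with `g₁` intertwining `Ψ` and Deligne's
`Ψ₀ = prodLift (snd ≫ (-p)) fst` on the split square, `dim A₁ = k` — VERBATIM the tensor-point clause of
`HodgeTheory.HasLocallyAlgebraicTensorAnchors k p` (Deligne's `A₀ ⊗ K`, Thm. 4.8 (b); André's `V₀ ⊗ E`, proof of Lemme 6.3.3).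
[cite: Deligne1982HodgeCycles, §4 Thm. 4.8 (b) and Remark 4.10] [cite: Andre1996Motifs, proof of Lemme 6.3.3 (p. 33)] -/
abbrev IsTensorPoint (k p : ℕ) (Y : AbelianVariety ℂ) (Ψ : Y ⟶ Y) : Prop :=
  Y.dim = 2 * k ∧ Ψ ≫ Ψ = -((p : ℤ) • 𝟙 Y) ∧
    ∃ (A₁ : AbelianVariety ℂ) (f₁ : Y ⟶ A₁.prod A₁) (g₁ : A₁.prod A₁ ⟶ Y) (m : ℕ),
      A₁.dim = k ∧ 0 < m ∧ f₁ ≫ g₁ = m • 𝟙 Y ∧ AlgebraicGeometry.Flat f₁.hom.hom.hom.left ∧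
      g₁ ≫ Ψ = AbelianVariety.prodLift (AbelianVariety.snd A₁ A₁ ≫ (-((p : ℤ) • 𝟙 A₁))) (AbelianVariety.fst A₁ A₁) ≫ g₁

/-- **Polarised tensor anchors** (anchor predicate for `AnchoredCarrierAt` / `HasServedFibre`): `X` is isomorphic to (the variety underlying)
a tensor point `(Y, Ψ)` of type `(k, p)`, and `θ` is a polarisation class of `X`. Reducible.
[cite: Deligne1982HodgeCycles, §4 Thm. 4.8 (b)] [cite: vanGeemen1994HodgeAV, 5.3–5.7] -/
abbrev tensorPolarisedAnchor (k p : ℕ) : ∀ X : SchemeOver ℂ, complexBetti X 2 → Prop :=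
  fun X θ ↦ (∃ (Y : AbelianVariety ℂ) (Ψ : Y ⟶ Y), IsTensorPoint k p Y Ψ ∧ Nonempty (Y.X ≅ X)) ∧ IsPolarizationClass (2 * k) X θ

/-- **Served classes at a tensor anchor: the WEIL CLASSES of its tensor structures** (served-class map, reducible; ignores `θ`): the classes
`w ∈ H^{2k}(X(ℂ); ℂ)` with `e^*w ∈ weilClassesOf Y Ψ k p` for some tensor point `(Y, Ψ)` and `e : Y.X ≅ X` — per structure a PLANE
(van Geemen Lemma 5.2 (5)), at the split square `ℂ·(R + i√p·S)ᵏ ⊕ ℂ·(R − i√p·S)ᵏ` for rational divisor classes `R`, `S`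
(`weilClassesOf_splitSquare_eq_span`), consisting of ALGEBRAIC, non-exceptional classes (`weilClassesOf_le_algebraicClasses_of_tensorPoint`).
Rationality is asked separately by `AnchoredCarrierAt`. [cite: vanGeemen1994HodgeAV, 4.9 and Lemma 5.2 (5)]
[cite: Deligne1982HodgeCycles, §4 Lemma 4.5 and Remark 4.10] -/
abbrev tensorWeilServedClasses (k p : ℕ) : ∀ X : SchemeOver ℂ, complexBetti X 2 → Set (complexBetti X (2 * k)) :=
  fun X _ ↦ {w | ∃ (Y : AbelianVariety ℂ) (Ψ : Y ⟶ Y) (e : Y.X ≅ X), IsTensorPoint k p Y Ψ ∧ complexBetti.map e.hom (2 * k) w ∈ weilClassesOf Y Ψ k p}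

/-- **CARRIERS FOR WEIL CLASSES AT TENSOR POINTS for the door `𝒪` (`TensorWeilCarriers 𝒪 k p`)**: on every complex scheme isomorphic to a
tensor point `(Y, Ψ)` of type `(k, p)` (`K = ℚ(√-p)`-isogenous to Deligne's split square `A₁ × A₁`, `dim A₁ = k`), for every polarisation class
`θ` and every RATIONAL Weil class `w` of a tensor structure on it: an `𝒪`-admissible datum `(I ∋ k, κ)` ON IT with `κ_k = a·w + c_k·θᵏ`,
`a ≠ 0`, `κ_q = c_q·θ^q` (`q ∈ I`, `q ≠ k`) — a semiregular representative, modulo the `θ`-ray, of the KNOWN algebraic class `w` (a signed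
sum of classes of abelian subvarieties). With the door's local variational Hodge statement it gives the Weil ladder's
`HasLocallyAlgebraicTensorAnchors k p` (companion proof file), hence — with Deligne's family — every Weil class for `K = ℚ(√-p)`, `p` prime,
`p ≡ 3 (4)`, `p ≥ 7`. OPEN; not in print; a HYPOTHESIS wherever used. [cite: Bloch1972Semiregularity, Remark (7.5)]
[cite: Deligne1982HodgeCycles, §4 Thm. 4.8 (b) and Remark 4.10] [cite: Andre1996Motifs, proof of Lemme 6.3.3 (p. 33)] -/
@[conjecture] def TensorWeilCarriers (𝒪 : ObjClass) (k p : ℕ) : Prop :=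
  AnchoredCarrierAt 𝒪 (2 * k) k (tensorPolarisedAnchor k p) (tensorWeilServedClasses k p)

/-- **TWISTED CARRIERS FOR WEIL CLASSES AT TENSOR POINTS (`TensorWeilTwistedCarriers k p`)**: `TensorWeilCarriers` for the road's twisted door
`twistedReflexiveClass C AdmTw` — `B`-twisted admissible perfect complexes, `AdmTw := gluableSigmaAdmissible ∨ bfSingleAdmissible` — for EVERY
Chern character theory `C`. OPEN; not in print (Markman's secant sheaves live at the secant anchors, not at tensor points); a HYPOTHESIS
wherever used. [cite: Bloch1972Semiregularity, Remark (7.5)] [cite: Markman2025SecantWeil, Thm. 1.4.1 and §7.3] [cite: BuchweitzFlenner2003, §5 Thm. 5.1] -/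
@[conjecture] def TensorWeilTwistedCarriers (k p : ℕ) : Prop :=
  ∀ C : ChernCharacterBetti, TensorWeilCarriers (twistedReflexiveClass C
    (fun n X₀ I E => Summit.Ventures.HSemireg.gluableSigmaAdmissible n X₀ I E ∨
      Literature.AlgebraicGeometry.HodgeTheory.bfSingleAdmissible n X₀ I E)) k p

end Summit.HodgeConjecture.HodgeConjecture.Ring2.AbelianAll

end
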